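import Summits.QuantumFields.BalabanUV.Beta.GAN24.CombBornBorderContactNest
import Summits.QuantumFields.BalabanUV.Beta.GAN24.CombBornBorderContactLineage
import Summits.QuantumFields.BalabanUV.Beta.GAN24.CombContactGaugeStaircaseMerged
import Summits.QuantumFields.BalabanUV.Beta.GAN24.BornBorderContactBound
import Summits.QuantumFields.BalabanUV.Beta.GAN24.CombLegEnvelope

/-!
# `BalabanUV.Beta.GAN24.CombBornBorderContactBound` — row G-an2-4 ∕ (CONV-C), TRANSFER-III, the (III′) S-slot (b): **THE BORN-V CONTACT LETTER `hCv` OF road-P2 M.104 IS A THEOREM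
# from `2 ≤ Lc` alone** (`d = 3`, pin `|cE| ≤ Lc^4`, every scale `cVH`, every sym record whose border table is an1's `symVhSAt ρ_t` at an in-block root): for EVERY lineage `i < k`,
# `LocStencil (D_{i,k} − U_{i,k}) (C·(k−i)^1·(Lc⁻¹)^{k−i}) δ` — `D_{i,k} = transport combUnitStepMap (i+1) (k−1−i) (combUnitStepMap Lc cE i (cVH • tabs.V))` the dressed (III′) V lineage,
# `U_{i,k}` its RAW undressed comparison — LITERALLY the body of M.104's `hCv` binder at `p = 1`, `θ = Lc⁻¹` (the (III′) twin of leaf-03 g55's (D) `BornBorderContactBound.exists_hCgV_three`)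
# (OWNER `b2b-balaban-gan24-p1` gen 55; (V-D′) of `HCV-DESIGN-g55.md`)

NOT IN PRINT — OUR PROOF ATTEMPT ((C4)-V END at (III′), [folklore] assembly BY NAME): per lineage `k = i+n+1` the OWNER's `CombBornBorderContactNest.combContact_v_eq_of_top ∕ _of_succ`
(NO `𝒯 − 1` defect: conjugated chain from the birth level, multiplier legs gauge-blind, RAW table), then (V-C2′) `CombBornBorderContactLineage.abs_weight_mul_comb_contact_v_le_three` with
the TREE letters: leaf-14's (N1) `RespStepDecay.exists_respStep_decay_and_grad`, the OWNER's conjugated envelope `CombLegEnvelope.exists_legChain_psiLeg_envelope`, road-P2 M.59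
`combLegChain_sub_respStep` (`T″ − B = dz λ′`), the OWNER's `CombContactGaugeStaircaseMerged.exists_combGauge_staircase_merged` (the `(hψ, hG)` pair, letter `A = (8Lc + F(1+8Lc(e^{κ₁}+1)))(1+Lc)`,
`F = faceWtSum (ctrOff 4 Lc) Lc`), asym1's `FibreStrip.unitDecayK_holds` through leaf-03's TABLE-FREE multiplier-leg tents `BornBorderContactBound.abs_legComp_colM∕rowMM_zsmul_le ∕
exists_legDecay_mulLegs ∕ legComp_respStep_self` BY NAME; the table cells are the OWNER's sym twins (B2′)(B3′) `SymContactBorderEntryBound(Mf)` over leaf-02 g47's `SymBorderGaugeLegContact`.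
0 `def`, 0 cited fact, 0 `def … : Prop`, 0 sorry; NO hypothesis beyond `2 ≤ Lc`, the pin, an in-block table root and the off-diagonal shape `hVff hVmm` of the record (displayed as in M.104).
HONEST FRAMING (cell contract, verbatim): «discharging `BetaPertH` makes Bałaban's UV stability UNCONDITIONAL — a real constructive-QFT result; it is NOT the continuum limit
and NOT the Clay problem.»  HONEST DEPENDENCY (verbatim): «continuum YM on T⁴ ⇐ BetaPertH ∧ nine spine estimates (0/9 proved); BetaPertH ⇐ (D1) ∧ (D4) ∧ CAP+tail; G-an2-4
gates asym, D1 and NE2/3/4.»  WHAT THIS DISCHARGES AND WHAT NOT: ONE of the four remaining contact letters of M.104 ∕ leaf-01 (20) `CombSRowsOfFourContactLetters` ∕ the OWNER's S54c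
`CombChargeRowsOfBornContactLetters` (`hCv`); `hCg` is leaf-01 g90's `CombBornLambdaContactBound`; the pairs `hPc ∕ hPcV` remain.  NOT (hS, hSall), NOT the END; NEVER «G-an2-4 closed» as
(CONV-C); NOT D1, NOT BetaPertH, NOT continuum, NOT Clay.  2026-08-28; no existing file touched.

## What is proved (`d = 3`, `2 ≤ Lc`)
* **`exists_comb_hCv_three (tabs) (hVff hVmm) (hLc) (hrt : rt ∈ box (3+1) Lc) (hV : tabs.V = symVhSAt (toSite rt) 3 Lc rfl) (cE cVH) (hcE : |cE| ≤ Lc^4)`** :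
  `∃ C θ δ, 0 ≤ C ∧ 0 ≤ θ ∧ θ < 1 ∧ 0 < δ ∧ ∀ k i, i < k → LocStencil (D_{i,k} − U_{i,k}) (C·((k−i)^1·θ^{k−i})) δ` — M.104's `hCv` binder at the record `tabs`, `p = 1`.
-/

noncomputable section

open scoped BigOperators
open Literature.MathematicalPhysics.QuantumFieldTheory
open Literature.MathematicalPhysics.QuantumFieldTheory.LatticeForm (quo)
open Literature.MathematicalPhysics.QuantumFieldTheory.Balaban1983to89
open Literature.MathematicalPhysics.QuantumFieldTheory.Balaban1983to89.Beta
open B4ContourShift (supNorm supNorm_nonneg)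
open B12Sec2to5 (l1 l1_nonneg)
open ExpKernelCalculus (MKer Decays Zl Zl_nonneg)
open AffineAveraging (Site box toSite)
open AffineReproduction (contourSumAdj)
open AveragingHessianKernels (ell)
open Summit.QuantumFields.BalabanUV.Beta.SymAveragingHessianCounts (symVhSAt)
open Summit.QuantumFields.BalabanUV.Beta.SymmetrisedStepJets (SymTables)
open Summit.QuantumFields.BalabanUV.Beta.SymCorrectorKernel (psiKS)
open Summit.QuantumFields.BalabanUV.Beta.SymCorrectorFace (faceWtSum faceWtSum_nonneg)
open AveragingContoursRooted (ctr ctrOff ctrOff_mem_box)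
open AveragingContours (blk)
open KKTFluctuationKernel (delta1)
open Summit.QuantumFields.BalabanUV.Beta.AxialProjectorBlockMean (bmGaugeAt)
open Summit.QuantumFields.BalabanUV.Beta.GAN24.RespStepBmDecompPsi (Psi)
open Summit.QuantumFields.BalabanUV.Beta.GAN24.CombLegChainGauge (PsiFace)
open OneStepResolventKernel (Fib LocStencil KInv)
open OneStepKernelFamily (dec)
open BalabanCompositeJets (respStep)
open Summit.QuantumFields.BalabanUV.Beta.GAN24.CombesThomas (sfStep smStep KStepUnit UnitDecayK)
open Summit.QuantumFields.BalabanUV.Beta.GAN24.FibreStrip (unitDecayK_holds)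
open Summit.QuantumFields.BalabanUV.Beta.GAN24.Push4 (legComp legComp_apply)
open Summit.QuantumFields.BalabanUV.Beta.GAN24.Push4Bounds (LegDecay)
open Summit.QuantumFields.BalabanUV.Beta.GAN24.Push4Iter (LegFam legChain)
open Summit.QuantumFields.BalabanUV.Beta.GAN24.Push4NestAux (legDecay_legComp)
open Summit.QuantumFields.BalabanUV.Beta.GAN24.Push3 (push₃)
open Summit.QuantumFields.BalabanUV.Beta.GAN24.AffineUnroll (transport)
open Summit.QuantumFields.BalabanUV.Beta.GAN24.RespStepSemigroup (respStep_self)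
open Summit.QuantumFields.BalabanUV.Beta.GAN24.RespStepBmDecompPsi (decays_KStepUnit_levels legComp_smul_left)
open Summit.QuantumFields.BalabanUV.Beta.GAN24.RespStepBmDecompExact (respStepBmSeq)
open Summit.QuantumFields.BalabanUV.Beta.GAN24.SrecLinearPartEq (colM rowMM reslot legDecay_colM legDecay_rowMM)
open Summit.QuantumFields.BalabanUV.Beta.GAN24.CombBornSector (combUnitStepMap)
open Summit.QuantumFields.BalabanUV.Beta.GAN24.UndressedResponseUnits (inv_cast_pow_pow)
open Summit.QuantumFields.BalabanUV.Beta.GAN24.RespStepDecay (exists_respStep_decay_and_grad)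
open Summit.QuantumFields.BalabanUV.Beta.GAN24.CombLegEnvelope (exists_legChain_psiLeg_envelope)
open Summit.QuantumFields.BalabanUV.Beta.GAN24.CombContactKernelCells (combLegChain_sub_respStep)
open Summit.QuantumFields.BalabanUV.Beta.GAN24.CombContactGaugeStaircaseMerged (exists_combGauge_staircase_merged)
open Summit.QuantumFields.BalabanUV.Beta.GAN24.BornLambdaBracketLetter (abs_unitColumnTent_le)
open Summit.QuantumFields.BalabanUV.Beta.GAN24.BornBorderTent (tentLeg tentLeg_zsmul legComp_colM_dec_respStep legComp_rowMM_dec_respStep)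
open Summit.QuantumFields.BalabanUV.Beta.GAN24.BornBorderLift (colM_KStepUnit rowMM_KStepUnit)
open Summit.QuantumFields.BalabanUV.Beta.GAN24.CombBornBorderContactNest (combContact_v_eq_of_succ combContact_v_eq_of_top)
open Summit.QuantumFields.BalabanUV.Beta.GAN24.CombBornBorderContactLineage (abs_weight_mul_comb_contact_v_le_three)
open Summit.QuantumFields.BalabanUV.Beta.GAN24.BornBorderContactBound (legComp_respStep_self abs_legComp_colM_zsmul_le abs_legComp_rowMM_zsmul_le exists_legDecay_mulLegs)

namespace Summit.QuantumFields.BalabanUV.Beta.GAN24.CombBornBorderContactBound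

section Three

variable {Lc : ℕ} [NeZero Lc] (tabs : SymTables 3 Lc) (hVff : ∀ κ u x y (α β : Fin (3 + 1)), tabs.V κ u x y (Sum.inl α) (Sum.inl β) = 0)
  (hVmm : ∀ κ u x y (μ ν : Fin (3 + 1)), tabs.V κ u x y (Sum.inr μ) (Sum.inr ν) = 0)
include hVff hVmm

/-- NOT IN PRINT; OUR PROOF ATTEMPT ([folklore] assembly BY NAME; `d = 3`, `2 ≤ Lc`; see the module docstring).  **THE (III′) BORN-V CONTACT LETTER `hCv`** — M.104's
binder at the record `tabs` (`tabs.V = symVhSAt ρ_t`), `p = 1`, `θ = Lc⁻¹`, rate `min δ_t κ₁ ∕ 96`. -/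
theorem exists_comb_hCv_three (hLc : 2 ≤ Lc) {rt : Fin (3 + 1) → ℕ} (hrt : rt ∈ box (3 + 1) Lc) (hV : tabs.V = symVhSAt (toSite rt) 3 Lc rfl)
    (cE cVH : ℝ) (hcE : |cE| ≤ (Lc : ℝ) ^ 4) :
    ∃ C θ δ : ℝ, 0 ≤ C ∧ 0 ≤ θ ∧ θ < 1 ∧ 0 < δ ∧ ∀ k i : ℕ, i < k →
      LocStencil (transport (combUnitStepMap Lc cE) (i + 1) (k - 1 - i)
          (combUnitStepMap Lc cE i (fun κ u => cVH • tabs.V κ u))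
        - fun κ' u' => (cE * (Lc : ℝ) ^ (2 * (3 + 1))) ^ (k - i) •
          push₃ (respStep (d := 3) (Lc ^ (i + 1)) (Lc ^ k)) (respStep (d := 3) (Lc ^ (i + 1)) (Lc ^ k)) (respStep (d := 3) (Lc ^ (i + 1)) (Lc ^ k))
            (fun κ u => -(push₃ (-respStep (d := 3) (Lc ^ i) (Lc ^ (i + 1))) (colM (KStepUnit (d := 3) Lc i) Lc)
                  (respStep (d := 3) (Lc ^ i) (Lc ^ (i + 1))) (reslot Sum.inl Sum.inr fun κ u => cVH • tabs.V κ u) κ u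
              + push₃ (rowMM (KStepUnit (d := 3) Lc i) Lc) (respStep (d := 3) (Lc ^ i) (Lc ^ (i + 1)))
                  (respStep (d := 3) (Lc ^ i) (Lc ^ (i + 1))) (reslot Sum.inr Sum.inl fun κ u => cVH • tabs.V κ u) κ u)) κ' u')
        (C * (((k - i : ℕ) : ℝ) ^ 1 * θ ^ (k - i))) δ := by
  have hLc1 : 1 ≤ Lc := le_trans (by norm_num) hLc
  have hL : (0 : ℝ) < (Lc : ℝ) := Nat.cast_pos.2 (Nat.pos_of_ne_zero (NeZero.ne Lc))
  -- the tree letters, constants outside every ∀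
  obtain ⟨κ₁, C₁, -, hκ₁, hC₁, -, hN1raw, -⟩ := exists_respStep_decay_and_grad (Lc := Lc)
  have hN1 : ∀ (m k : ℕ) (μ : Fin (3 + 1)) (z : Site (3 + 1)) (l'' : Fin (3 + 1)) (w' : Site (3 + 1)),
      |respStep (d := 3) (Lc ^ m) (Lc ^ (m + k + 1)) μ z l'' w'| ≤
        C₁ * ((Lc : ℝ) ^ (5 * (k + 1)))⁻¹ * Real.exp (-(κ₁ * supNorm (quo (Lc ^ (k + 1)) w' - z))) := by
    intro m k μ z l'' w'
    have h := hN1raw m k μ z l'' w'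
    rwa [inv_cast_pow_pow] at h
  obtain ⟨κE, KE, hκE, -, hEnv⟩ := exists_legChain_psiLeg_envelope (Lc := Lc) hLc
  have hr : ctrOff (3 + 1) Lc ∈ box (3 + 1) Lc := ctrOff_mem_box hLc1
  have hA : 0 ≤ ((8 * (Lc : ℝ) + faceWtSum (ctrOff (3 + 1) Lc) Lc * (1 + 8 * (Lc : ℝ) * (Real.exp κ₁ + 1))) * (1 + (Lc : ℝ))) := by
    have hF0 := faceWtSum_nonneg (ctrOff (3 + 1) Lc) Lc
    positivity
  obtain ⟨κ₀, hκ₀, Cst, hK⟩ := unitDecayK_holds (Lc := Lc)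
  have hδt : 0 < κ₀ / ((3 + 1) * (Lc : ℝ)) := by positivity
  have hCt : 0 ≤ Cst * Real.exp (2 * κ₀) := (hK 0).nonneg (Sum.inl 0)
  have hTb : 0 ≤ Cst * Real.exp (2 * κ₀) * Real.exp (κ₀ / ((3 + 1) * (Lc : ℝ))) := by positivity
  have hκ : 0 < min (κ₀ / ((3 + 1) * (Lc : ℝ))) κ₁ := lt_min hδt hκ₁
  have hZ : 0 ≤ Zl (3 + 1) (min (κ₀ / ((3 + 1) * (Lc : ℝ))) κ₁ / (4 * ((3 : ℝ) + 1))) := Zl_nonneg (by positivity)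
  refine ⟨|cVH| * (2 * ((Lc : ℝ) ^ 3 * (((((3 + 1).factorial : ℕ) : ℝ) * (Lc : ℝ) ^ (3 + 1))⁻¹ * (((3 : ℝ) + 1) * (Cst * Real.exp (2 * κ₀) * Real.exp (κ₀ / ((3 + 1) * (Lc : ℝ))))
            * (Real.exp (2 * ((3 : ℝ) + 1) * min (κ₀ / ((3 + 1) * (Lc : ℝ))) κ₁) ^ 2 *
              (((2 * Lc : ℕ) : ℝ) ^ (3 + 1) * (((3 + 1 : ℕ) : ℝ) * ((((3 + 1).factorial : ℕ) : ℝ) * ((Lc : ℝ) ^ (3 + 1) * (ell (3 + 1) Lc : ℝ)))))))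
            * (C₁ ^ 2 * (4 * ((8 * (Lc : ℝ) + faceWtSum (ctrOff (3 + 1) Lc) Lc * (1 + 8 * (Lc : ℝ) * (Real.exp κ₁ + 1))) * (1 + (Lc : ℝ))) + 4 * ((8 * (Lc : ℝ) + faceWtSum (ctrOff (3 + 1) Lc) Lc * (1 + 8 * (Lc : ℝ) * (Real.exp κ₁ + 1))) * (1 + (Lc : ℝ))) ^ 2 + 4 * ((8 * (Lc : ℝ) + faceWtSum (ctrOff (3 + 1) Lc) Lc * (1 + 8 * (Lc : ℝ) * (Real.exp κ₁ + 1))) * (1 + (Lc : ℝ))) * Lc + 8 * ((8 * (Lc : ℝ) + faceWtSum (ctrOff (3 + 1) Lc) Lc * (1 + 8 * (Lc : ℝ) * (Real.exp κ₁ + 1))) * (1 + (Lc : ℝ))) ^ 2 * Lc)) * Zl (3 + 1) (min (κ₀ / ((3 + 1) * (Lc : ℝ))) κ₁ / (4 * ((3 : ℝ) + 1)))))),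
    (Lc : ℝ)⁻¹, min (κ₀ / ((3 + 1) * (Lc : ℝ))) κ₁ / 12 / 2 / ((3 : ℝ) + 1), by positivity, (inv_pos.2 hL).le, ?_, by positivity, ?_⟩
  · have h2 : (2 : ℝ) ≤ Lc := by exact_mod_cast hLc
    rw [inv_lt_one_iff₀]; right; linarith
  intro k i hik
  obtain ⟨n, rfl⟩ : ∃ n, k = i + n + 1 := ⟨k - i - 1, by omega⟩
  -- the lineage's dressed envelope
  have hE : ∀ μ z' l u, |legChain (fun j => legComp (fun α x κ u => psiKS (ctrOff (3 + 1) Lc) Lc u x (Sum.inl κ) (Sum.inl α)) (respStepBmSeq (d := 3) (ctr (3 + 1) Lc) Lc j)) i n μ z' l u|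
      ≤ (KE * ((n : ℝ) + 1) * ((Lc : ℝ) ^ (4 * (n + 1)))⁻¹) * Real.exp (-(κE * supNorm (quo (Lc ^ (n + 1)) u - z'))) :=
    fun μ z' l u => hEnv _ hr _ hr i n μ z' l u
  -- the pure-gauge family of the conjugated chain (M.59) and its staircase of the legs' own depth (OWNER `exists_combGauge_staircase_merged`)
  have hTB := combLegChain_sub_respStep (d := 3) (Lc := Lc) hr hr i n
  obtain ⟨G, hψ', hG'⟩ := exists_combGauge_staircase_merged (Lc := Lc) hκ₁.le hC₁ hN1 hr hr le_rfl i n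
  have hψ : ∀ (μ₀ : Fin (3 + 1)) (z₀ u : Site (3 + 1)),
      (Psi (toSite (ctrOff (3 + 1) Lc)) Lc i n (delta1 μ₀ z₀) + PsiFace (ctrOff (3 + 1) Lc) (toSite (ctrOff (3 + 1) Lc)) Lc i n (delta1 μ₀ z₀)
          - bmGaugeAt (toSite (ctrOff (3 + 1) Lc)) (respStep (d := 3) (Lc ^ i) (Lc ^ (i + n + 1)) μ₀ z₀) Lc) u
        = ∑ s ∈ Finset.range (n + 1), G μ₀ z₀ s (blk (Lc ^ s) u) := fun μ₀ z₀ u => by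
    simpa only [Pi.add_apply, Pi.sub_apply] using hψ' μ₀ z₀ u
  have hGA : ∀ (μ₀ : Fin (3 + 1)) (z₀ : Site (3 + 1)) (s : ℕ), s ≤ n → ∀ u : Site (3 + 1),
      |G μ₀ z₀ s (blk (Lc ^ s) u)| ≤ ((8 * (Lc : ℝ) + faceWtSum (ctrOff (3 + 1) Lc) Lc * (1 + 8 * (Lc : ℝ) * (Real.exp κ₁ + 1))) * (1 + (Lc : ℝ))) * C₁ * ((Lc : ℝ) ^ (5 * (n + 1)))⁻¹ * (Lc : ℝ) ^ s
        * Real.exp (-(κ₁ * supNorm (quo (Lc ^ (n + 1)) u - z₀))) := fun μ₀ z₀ s hs u => by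
    refine (hG' μ₀ z₀ s hs u).trans (le_of_eq ?_)
    ring
  intro κ' u'
  simp only [Pi.sub_apply]
  cases n with
  | zero =>
    -- the top lineage: multiplier legs `colM ∕ rowMM K̃_i Lc`
    obtain ⟨CK, mK, hmK, hKi⟩ := decays_KStepUnit_levels (d := 3) (Lc := Lc) i
    have hcol : LegDecay (colM (KStepUnit (d := 3) Lc i) Lc) Lc CK mK := legDecay_colM hKi
    have hrow : LegDecay (rowMM (KStepUnit (d := 3) Lc i) Lc) Lc CK mK := legDecay_rowMM hKi
    have hMt : ∀ (a : Fin (3 + 1)) (b : Site (3 + 1)) (μ : Fin (3 + 1)) (y : Site (3 + 1)),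
        |colM (KStepUnit (d := 3) Lc i) Lc a b μ ((Lc : ℤ) • y)| ≤ Cst * Real.exp (2 * κ₀) * Real.exp (κ₀ / ((3 + 1) * (Lc : ℝ)))
          * ((((Lc : ℝ) ^ 0) ^ (2 * 3 + 1))⁻¹) * Real.exp (-(κ₀ / ((3 + 1) * (Lc : ℝ)) * supNorm (quo (Lc ^ 0) y - b))) := by
      intro a b μ y
      have h := abs_legComp_colM_zsmul_le hK hδt.le i 0 a b μ y
      simp only [Nat.add_zero, legComp_respStep_self] at h
      exact h
    have hM't : ∀ (a : Fin (3 + 1)) (b : Site (3 + 1)) (μ : Fin (3 + 1)) (y : Site (3 + 1)),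
        |rowMM (KStepUnit (d := 3) Lc i) Lc a b μ ((Lc : ℤ) • y)| ≤ Cst * Real.exp (2 * κ₀) * Real.exp (κ₀ / ((3 + 1) * (Lc : ℝ)))
          * ((((Lc : ℝ) ^ 0) ^ (2 * 3 + 1))⁻¹) * Real.exp (-(κ₀ / ((3 + 1) * (Lc : ℝ)) * supNorm (quo (Lc ^ 0) y - b))) := by
      intro a b μ y
      have h := abs_legComp_rowMM_zsmul_le hK hδt.le i 0 a b μ y
      simp only [Nat.add_zero, legComp_respStep_self] at h
      exact h
    rw [combContact_v_eq_of_top tabs hVff hVmm cE cVH rfl κ' u', hV]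
    intro x z a b
    simp only [Pi.neg_apply, Pi.smul_apply, Pi.add_apply, Pi.sub_apply, smul_eq_mul, abs_neg]
    have H := abs_weight_mul_comb_contact_v_le_three (cVH := cVH) hLc hrt hcE hN1 hκ₁ hC₁ hE hκE hTB hA hψ hGA (hcol.summable hmK) hMt (fun a b μ z => hrow.abs_le hmK.le a b μ z)
      (hrow.summable hmK) hM't hδt hTb κ' u' x z a b
    have e2 : i + 0 + 1 - i = 0 + 1 := by omega
    simpa only [e2, pow_one, Nat.cast_succ, Nat.cast_zero] using H
  | succ m =>
    -- a nested lineage: composite multiplier legs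
    obtain ⟨N, CM, mM, hmM, hcol, hrow⟩ := exists_legDecay_mulLegs (d := 3) (Lc := Lc) i (m + 1)
    have hMt := fun (a : Fin (3 + 1)) (b : Site (3 + 1)) (μ : Fin (3 + 1)) (y : Site (3 + 1)) => abs_legComp_colM_zsmul_le hK hδt.le i (m + 1) a b μ y
    have hM't := fun (a : Fin (3 + 1)) (b : Site (3 + 1)) (μ : Fin (3 + 1)) (y : Site (3 + 1)) => abs_legComp_rowMM_zsmul_le hK hδt.le i (m + 1) a b μ y
    rw [combContact_v_eq_of_succ tabs hVff hVmm cE cVH hLc rfl κ' u', hV]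
    intro x z a b
    simp only [Pi.neg_apply, Pi.smul_apply, Pi.add_apply, Pi.sub_apply, smul_eq_mul, abs_neg]
    have H := abs_weight_mul_comb_contact_v_le_three (cVH := cVH) hLc hrt hcE hN1 hκ₁ hC₁ hE hκE hTB hA hψ hGA (hcol.summable hmM) hMt (fun a b μ z => hrow.abs_le hmM.le a b μ z)
      (hrow.summable hmM) hM't hδt hTb κ' u' x z a b
    have e2 : i + (m + 1) + 1 - i = m + 1 + 1 := by omega
    simpa only [e2, pow_one, Nat.cast_succ] using H


end Three

end Summit.QuantumFields.BalabanUV.Beta.GAN24.CombBornBorderContactBound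

end
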